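import Summits.QuantumFields.YangMills.Theorems.BalabanUVNodesN15KingModelPotentialAnalyticLimit
import Literature.MathematicalPhysics.QuantumFieldTheory.Balaban1983to89.B13RealSliceEntryLetters

/-!
# N15 (NE2) King-model rung, PART 34 — THE LETTERS ON THE COMPLEX SUP-BALL OF POTENTIALS ([B9] Thm 3.4, multi-variable, from the real slice):
# the dressed levels and covariances at a COMPLEX POTENTIAL are exponentially local, uniformly in the cutoff, the volume and the potential

Eleventh generation (g11) of the seat `pub-ymgap-dag-n15-d`, part 34 (on 29 `…PotentialAnalytic` ∕ 30 `…PotentialAnalyticLimit` and the Literature module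
`Balaban1983to89.B13RealSliceEntryLetters`).  Part 29 proved [B9] Theorem 3.4 in King's A = 0 model in its MULTI-VARIABLE form: for `L ≥ 2`, `a, m² > 0`,
`k ≥ 1` the dressed covariance `C^{(k)}_w = (Δ^{(k)}_w + aL⁻²Q*Q)⁻¹` is an entrywise ANALYTIC function of the COMPLEX potential `w : X_k → ℂ` on the
sup-ball `‖w‖_∞ < r_K`, bounded there by `2∕γ₀`; part 30 identified its values at REAL potentials with 9c's dressed covariances (`kingCovCPot_ofReal`).
On real potentials 9c proved the (4.34)-type locality `|C^{(k)}_w(x,y)| ≤ (4∕γ₀)e^{−κ′|x−y|}` (`kingCovPot_decay`) and `uniformKernelDecay_kingTowerPot`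
for the levels.  The two-constants theorem along the complex lines `re u + ζ·im u` of the chart `realStructurePi` (`B13RealSliceEntryLetters.decay_of_realSlice`,
cited BY NAME — the device of [B13] p.15 ∕ [B9] (3.108)) transports the real-slice decay to the COMPLEX sup-ball:

* §1 `exists_tower_at` (a one-level potential extends to a potential tower, zero at the other cutoffs, same size — so 9c's tower-indexed theorems
  read one level), `exists_real_of_mem_Ereal_pi` (a point of `realStructurePi.Ereal` is a real potential of the same sup norm), `cpotWindow_facts`
  (the common real∕complex window `min(r_K, potWindow)`: positive; inside it 29's and 9c's conditions hold); no definitions;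
* §2 ★★ `kingCovCPot_apply_decay` — **(4.34)(i) ON THE COMPLEX SUP-BALL**: for every `0 < r < 1` and every complex potential with
  `‖w‖_∞ < (r∕(1+r))·min(r_K, potWindow)`: `‖C^{(k)}_w(x,y)‖ ≤ (4∕γ₀)·e^{−(1−λ(r))κ′|x−y|_T}`, uniformly in `k ≥ 1`, the volume and `w`;
* §3 ★ `kingLevelCPot_apply_decay` — **(4.34)(ii) ON THE COMPLEX SUP-BALL**: `‖Δ^{(k)}_w(b,b′)‖ ≤ M_Δ·e^{−(1−λ(r))·2κ′·|b−b′|_T}`, `M_Δ = max(a + a²ctCK, a + 2a²∕m²)`;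
* §4 ★★ `kingCovCPot_letters` — the three letters of Theorem 3.4 on the complex sup-ball in one statement: analyticity (29), the bound `2∕γ₀` (29) and locality (§2).

References (method): two-constants theorem [Ransford1995, Thm. 4.3.7] via the tree's `TwoConstantsDisc` ∕ `B13RealSliceEntryLetters` (BY NAME); template [B9]
Thm 3.4 p.400, (3.108) p.416; [B13] p.15; King (4.34) p.674.

HONEST SCOPE.  King's A = 0 SCALAR model (any unit torus `Π ℤ∕(LM_μ)`, `L ≥ 2`, `a, m² > 0`); a complex POTENTIAL (multiplication operator) — NOT a gauge
field, NOT Bałaban's `U′U`; losses = those of the two-constants theorem (radius `r∕(1+r)`, exponent `1 − λ(r)`); no two-spacing RATE is claimed here for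
complex potentials (that needs a coherent tower; see 32 ∕ 33 for complex LINES through real towers); NOT a node discharge; count-neutral.  No `sorry`.
-/

noncomputable section

open scoped BigOperators Matrix
open Filter Topology Metric Finset Complex

namespace Summit.QuantumFields.YangMills.BalabanUVNodes.N15.KingModel

open Literature.MathematicalPhysics.QuantumFieldTheory.Balaban1983to89 hiding blockOf
open Literature.MathematicalPhysics.QuantumFieldTheory.Balaban1983to89.B5Prop11Plancherel (Tor fine)
open Literature.MathematicalPhysics.QuantumFieldTheory.Balaban1983to89.B13RealSliceEntryLetters (lam lam_nonneg lam_lt_one lam_le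
  decay_of_realSlice realStructurePi)
open Literature.MathematicalPhysics.QuantumFieldTheory.King1986 (aK aK_pos aK_le)
open Literature.MathematicalPhysics.QuantumFieldTheory.King1986.Torus (gam0L gam0L_pos tdistT tdistT_isPseudoDist kapCT kapCT_pos_le
  gamA_pos aminL_pos)

variable {d : ℕ}

section SupBall

variable {a m2 : ℝ} {L : ℕ} [NeZero L] {M : Fin (d + 1) → ℕ} [∀ μ, NeZero (M μ)]

/-! ## §1 One-level potentials as towers; real points of the chart; the common window (no definitions) -/

omit [NeZero L] [∀ μ, NeZero (M μ)] in
/-- **A ONE-LEVEL POTENTIAL EXTENDS TO A TOWER** (the given potential at the cutoff `N = L^k`, zero at every other cutoff), with the same size bound —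
so that 9c's tower-indexed theorems read a single dressed level. [folklore] -/
theorem exists_tower_at (k : ℕ) {u : Tor (fine (L ^ k) (fine L M)) → ℝ} {w₀ : ℝ} (hw₀ : 0 ≤ w₀) (hu : ∀ x, |u x| ≤ w₀) :
    ∃ v : ∀ N : ℕ, Tor (fine N (fine L M)) → ℝ, v (L ^ k) = u ∧ ∀ N x, |v N x| ≤ w₀ := by
  refine ⟨fun N => if h : N = L ^ k then fun x => u (cast (congrArg (fun n => Tor (fine n (fine L M))) h) x) else fun _ => 0, ?_, ?_⟩
  · funext x
    simp
  · intro N x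
    by_cases h : N = L ^ k
    · simp only [h, ↓reduceDIte]
      exact hu _
    · simp only [h, ↓reduceDIte, abs_zero]
      exact hw₀

/-- A point of `realStructurePi.Ereal` (coordinatewise real) IS a real potential read over ℂ, with the same coordinate bounds. [folklore] -/
theorem exists_real_of_mem_Ereal_pi {k : ℕ} {u : Tor (fine (L ^ k) (fine L M)) → ℂ}
    (hu : u ∈ (realStructurePi (Tor (fine (L ^ k) (fine L M)))).Ereal) :
    ∃ w : Tor (fine (L ^ k) (fine L M)) → ℝ, (fun x => (w x : ℂ)) = u ∧ ∀ x, |w x| ≤ ‖u‖ := by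
  refine ⟨fun x => (u x).re, ?_, fun x => ?_⟩
  · funext x
    have hx : (u x).im = 0 := hu x
    apply Complex.ext <;> simp [hx]
  · exact (Complex.abs_re_le_norm (u x)).trans (norm_le_pi_norm u x)

omit [NeZero L] [∀ μ, NeZero (M μ)] in
/-- `ctCK > 0`. [folklore] -/
theorem ctCK_pos (ha : 0 < a) (hL : 2 ≤ L) : 0 < ctCK (d + 1) a L := by
  unfold ctCK
  have := gamA_pos (aminL_pos ha hL) (d + 1)
  positivity

omit [NeZero L] [∀ μ, NeZero (M μ)] in
/-- `kwSum > 0`. [folklore] -/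
theorem kwSum_pos (ha : 0 < a) (hL : 2 ≤ L) : 0 < kwSum (d + 1) a L :=
  latticeConst_pos (d + 1) (by have := (kapCT_pos_le (d := d + 1) ha hL).1; positivity)

omit [NeZero L] [∀ μ, NeZero (M μ)] in
/-- **THE COMMON WINDOW** `min(r_K, potWindow)` (`potWindow = min(min(w̄, c̄), c̄∕(a²·ctCK²·kwSum))`, 9d) is positive, and inside it 29's complex
condition (`≤ r_K`) and 9c's real-slice conditions (`≤ w̄`, `a²·ctCK²·kwSum·w₀ ≤ c̄`) all hold. [folklore] -/
theorem cpotWindow_facts (ha : 0 < a) (hm : 0 < m2) (hL : 2 ≤ L) :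
    0 < min (cplxWindow d a m2 L) (potWindow (d + 1) a L) ∧
      ∀ w₀ : ℝ, w₀ ≤ min (cplxWindow d a m2 L) (potWindow (d + 1) a L) →
        w₀ ≤ cplxWindow d a m2 L ∧ w₀ ≤ wbarK (d + 1) a L ∧ a ^ 2 * ctCK (d + 1) a L ^ 2 * kwSum (d + 1) a L * w₀ ≤ kingCbar (d + 1) a L := by
  refine ⟨lt_min (cplxWindow_pos (d := d) (a := a) (m2 := m2) (L := L) ha hm hL) (potWindow_pos (d := d) ha hL), fun w₀ h => ?_⟩
  have hp : w₀ ≤ potWindow (d + 1) a L := h.trans (min_le_right _ _)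
  refine ⟨h.trans (min_le_left _ _), hp.trans ((min_le_left _ _).trans (min_le_left _ _)), ?_⟩
  have h3 : w₀ ≤ kingCbar (d + 1) a L / (a ^ 2 * ctCK (d + 1) a L ^ 2 * kwSum (d + 1) a L) := hp.trans (min_le_right _ _)
  have hc := ctCK_pos (d := d) ha hL
  have hk := kwSum_pos (d := d) ha hL
  have hpos : 0 < a ^ 2 * ctCK (d + 1) a L ^ 2 * kwSum (d + 1) a L := by positivity
  rw [le_div_iff₀ hpos] at h3
  linarith [mul_comm (a ^ 2 * ctCK (d + 1) a L ^ 2 * kwSum (d + 1) a L) w₀]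

/-! ## §2 (4.34)(i) on the complex sup-ball of potentials -/

/-- ★★ **(4.34)(i) ON THE COMPLEX SUP-BALL — THE DRESSED COVARIANCE AT A COMPLEX POTENTIAL IS EXPONENTIALLY LOCAL.**  For `L ≥ 2`, `a, m² > 0`,
`k ≥ 1`, every `0 < r < 1` and every COMPLEX potential `w : X_k → ℂ` with `‖w‖_∞ < (r∕(1+r))·min(r_K, potWindow)`:
`‖C^{(k)}_w(x,y)‖ ≤ (4∕γ₀)·e^{−(1−λ(r))·κ′·|x−y|_T}` (`κ′ = kapCT`), uniformly in `k`, the volume and `w` — analyticity and the bound `2∕γ₀` on the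
sup-ball (29 `analyticAt_kingCovCPot_apply`, `kingCovCPot_apply_norm_le`), the real-slice decay (9c `kingCovPot_decay` through `exists_tower_at`), and the
two-constants theorem along the lines of `realStructurePi` (`decay_of_realSlice`, BY NAME).
[cite: Balaban1985BackgroundPropagators, Thm 3.4 p.400, (3.108) p.416 (template); King1986, (4.34) p.674 (A = 0); Ransford1995, Thm. 4.3.7] -/
theorem kingCovCPot_apply_decay (ha : 0 < a) (hm : 0 < m2) (hL : 2 ≤ L) {k : ℕ} (hk : 1 ≤ k) {r : ℝ} (hr0 : 0 < r) (hr1 : r < 1)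
    {w : Tor (fine (L ^ k) (fine L M)) → ℂ} (hw : ‖w‖ < r / (1 + r) * min (cplxWindow d a m2 L) (potWindow (d + 1) a L)) (x y : Tor (fine L M)) :
    ‖kingCovCPot d a m2 L M k w x y‖ ≤ 4 / gam0L (d + 1) a L * Real.exp (-((1 - lam r) * kapCT (d + 1) a L * tdistT (fine L M) x y)) := by
  set R : ℝ := min (cplxWindow d a m2 L) (potWindow (d + 1) a L) with hR
  have hRpos : 0 < R := (cpotWindow_facts (d := d) (a := a) (m2 := m2) (L := L) ha hm hL).1
  have hγ := gam0L_pos (d := d + 1) ha hL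
  have hκ := (kapCT_pos_le (d := d + 1) ha hL).1
  set B : ℝ := 4 / gam0L (d + 1) a L with hB
  have hB0 : 0 ≤ B := by positivity
  set K : (Tor (fine (L ^ k) (fine L M)) → ℂ) → Matrix (Tor (fine L M)) (Tor (fine L M)) ℂ := fun u => kingCovCPot d a m2 L M k u with hK
  -- the window conditions at any `u` of the ball
  have hwin : ∀ u : (Tor (fine (L ^ k) (fine L M)) → ℂ), ‖u‖ < R → (∀ x, ‖u x‖ ≤ ‖u‖) ∧ ‖u‖ ≤ cplxWindow d a m2 L := fun u hu =>
    ⟨fun x => norm_le_pi_norm u x, ((cpotWindow_facts (d := d) (a := a) (m2 := m2) (L := L) ha hm hL).2 _ hu.le).1⟩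
  have hKd : ∀ i j, DifferentiableOn ℂ (fun u => K u i j) (ball (0 : (Tor (fine (L ^ k) (fine L M)) → ℂ)) R) := by
    intro i j u hu
    rw [mem_ball_zero_iff] at hu
    obtain ⟨hux, huK⟩ := hwin u hu
    exact (analyticAt_kingCovCPot_apply (M := M) ha hm hL hk (norm_nonneg u) hux huK i j).differentiableAt.differentiableWithinAt
  have hKM : ∀ u ∈ ball (0 : Tor (fine (L ^ k) (fine L M)) → ℂ) R, ∀ i j, ‖K u i j‖ ≤ B := by
    intro u hu i j
    rw [mem_ball_zero_iff] at hu
    obtain ⟨hux, huK⟩ := hwin u hu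
    refine (kingCovCPot_apply_norm_le (M := M) ha hm hL hk (norm_nonneg u) hux huK i j).trans ?_
    rw [hB, div_le_div_iff_of_pos_right hγ]
    norm_num
  have hKB : ∀ u ∈ (realStructurePi (Tor (fine (L ^ k) (fine L M)))).Ereal, ‖u‖ < R → ∀ i j, ‖K u i j‖ ≤ B * Real.exp (-(kapCT (d + 1) a L * tdistT (fine L M) i j)) := by
    intro u hu huR i j
    obtain ⟨w', hw'u, hw'le⟩ := exists_real_of_mem_Ereal_pi hu
    obtain ⟨-, hwb, hsmall⟩ := (cpotWindow_facts (d := d) (a := a) (m2 := m2) (L := L) ha hm hL).2 _ huR.le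
    obtain ⟨v, hvk, hv⟩ := exists_tower_at (L := L) (M := M) k (norm_nonneg u) hw'le
    have hdec := kingCovPot_decay (M := M) ha hm hL (norm_nonneg u) hwb hv hsmall k i j
    show ‖kingCovCPot d a m2 L M k u i j‖ ≤ _
    rw [← hw'u, kingCovCPot_ofReal, Matrix.map_apply, Complex.norm_real, Real.norm_eq_abs]
    rw [kingTowerPot_of_one_le _ hk, hvk] at hdec
    exact hdec
  have hdist : ∀ i j : Tor (fine L M), 0 ≤ tdistT (fine L M) i j := (tdistT_isPseudoDist (fine L M)).nonneg
  have key := decay_of_realSlice (realStructurePi (Tor (fine (L ^ k) (fine L M)))) hKd hKM hKB hB0 le_rfl hκ.le hdist hr0 hr1 w (by rwa [mem_ball_zero_iff]) x y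
  refine key.trans (le_of_eq ?_)
  have hsum : (1 - lam r) + lam r = 1 := by ring
  rw [← Real.rpow_add' hB0 (by rw [hsum]; exact one_ne_zero), hsum, Real.rpow_one]

/-! ## §3 (4.34)(ii) on the complex sup-ball of potentials -/

/-- ★ **(4.34)(ii) ON THE COMPLEX SUP-BALL — THE DRESSED LEVEL AT A COMPLEX POTENTIAL IS EXPONENTIALLY LOCAL.**  For `L ≥ 2`, `a, m² > 0`, `k ≥ 1`,
every `0 < r < 1` and every complex potential with `‖w‖_∞ < (r∕(1+r))·min(r_K, potWindow)`:
`‖Δ^{(k)}_w(b,b′)‖ ≤ max(a + a²·ctCK, a + 2a²∕m²)·e^{−(1−λ(r))·2κ′·|b−b′|_T}` — 29∕30's analyticity and bound on the sup-ball, 9c's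
`uniformKernelDecay_kingTowerPot` on the real slice (through `exists_tower_at`), `decay_of_realSlice` BY NAME.
[cite: Balaban1985BackgroundPropagators, Thm 3.4 p.400 (template); King1986, (4.34) p.674 (A = 0); Ransford1995, Thm. 4.3.7] -/
theorem kingLevelCPot_apply_decay (ha : 0 < a) (hm : 0 < m2) (hL : 2 ≤ L) {k : ℕ} (hk : 1 ≤ k) {r : ℝ} (hr0 : 0 < r) (hr1 : r < 1)
    {w : Tor (fine (L ^ k) (fine L M)) → ℂ} (hw : ‖w‖ < r / (1 + r) * min (cplxWindow d a m2 L) (potWindow (d + 1) a L)) (b b' : Tor (fine L M)) :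
    ‖kingLevelCPot d a m2 L M k w b b'‖
      ≤ max (a + a ^ 2 * ctCK (d + 1) a L) (a + 2 * a ^ 2 / m2)
          * Real.exp (-((1 - lam r) * (2 * kapCT (d + 1) a L) * tdistT (fine L M) b b')) := by
  set R : ℝ := min (cplxWindow d a m2 L) (potWindow (d + 1) a L) with hR
  have hRpos : 0 < R := (cpotWindow_facts (d := d) (a := a) (m2 := m2) (L := L) ha hm hL).1
  have hκ := (kapCT_pos_le (d := d + 1) ha hL).1
  have hCK := (dressedConsts_nonneg (d := d) ha hL).1
  set B : ℝ := a + a ^ 2 * ctCK (d + 1) a L with hB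
  set Mb : ℝ := max B (a + 2 * a ^ 2 / m2) with hMb
  have hB0 : 0 ≤ B := by positivity
  set K : (Tor (fine (L ^ k) (fine L M)) → ℂ) → Matrix (Tor (fine L M)) (Tor (fine L M)) ℂ := fun u => kingLevelCPot d a m2 L M k u with hK
  have hwin : ∀ u : (Tor (fine (L ^ k) (fine L M)) → ℂ), ‖u‖ < R → (∀ x, ‖u x‖ ≤ ‖u‖) ∧ ‖u‖ ≤ cplxWindow d a m2 L := fun u hu =>
    ⟨fun x => norm_le_pi_norm u x, ((cpotWindow_facts (d := d) (a := a) (m2 := m2) (L := L) ha hm hL).2 _ hu.le).1⟩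
  have hKd : ∀ i j, DifferentiableOn ℂ (fun u => K u i j) (ball (0 : (Tor (fine (L ^ k) (fine L M)) → ℂ)) R) := by
    intro i j u hu
    rw [mem_ball_zero_iff] at hu
    obtain ⟨hux, huK⟩ := hwin u hu
    have hum : ‖u‖ < m2 := lt_of_le_of_lt (huK.trans (min_le_left _ _)) (by linarith)
    exact (analyticAt_kingLevelCPot_apply (M := M) (m2 := m2) ha hL hk hux hum i j).differentiableAt.differentiableWithinAt
  have hKM : ∀ u ∈ ball (0 : Tor (fine (L ^ k) (fine L M)) → ℂ) R, ∀ i j, ‖K u i j‖ ≤ Mb := by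
    intro u hu i j
    rw [mem_ball_zero_iff] at hu
    obtain ⟨hux, huK⟩ := hwin u hu
    exact (norm_kingLevelCPot_apply_le (M := M) ha hm hL hk hux huK i j).trans (le_max_right _ _)
  have hKB : ∀ u ∈ (realStructurePi (Tor (fine (L ^ k) (fine L M)))).Ereal, ‖u‖ < R → ∀ i j, ‖K u i j‖ ≤ B * Real.exp (-((2 * kapCT (d + 1) a L) * tdistT (fine L M) i j)) := by
    intro u hu huR i j
    obtain ⟨w', hw'u, hw'le⟩ := exists_real_of_mem_Ereal_pi hu
    obtain ⟨-, hwb, -⟩ := (cpotWindow_facts (d := d) (a := a) (m2 := m2) (L := L) ha hm hL).2 _ huR.le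
    obtain ⟨v, hvk, hv⟩ := exists_tower_at (L := L) (M := M) k (norm_nonneg u) hw'le
    have hlo : ∀ N x', -‖u‖ ≤ v N x' := fun N x' => (abs_le.mp (hv N x')).1
    have hdec := uniformKernelDecay_kingTowerPot (M := M) (m2 := m2) ha hm hL hwb hlo k i j
    show ‖kingLevelCPot d a m2 L M k u i j‖ ≤ _
    rw [← hw'u, kingLevelCPot_ofReal, Matrix.map_apply, Complex.norm_real, Real.norm_eq_abs]
    rw [kingTowerPot_of_one_le _ hk, hvk] at hdec
    simpa only [mul_assoc] using hdec
  have hdist : ∀ i j : Tor (fine L M), 0 ≤ tdistT (fine L M) i j := (tdistT_isPseudoDist (fine L M)).nonneg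
  have key := decay_of_realSlice (realStructurePi (Tor (fine (L ^ k) (fine L M)))) hKd hKM hKB hB0 (le_max_left _ _) (by positivity) hdist hr0 hr1 w
    (by rwa [mem_ball_zero_iff]) b b'
  refine key.trans (mul_le_mul_of_nonneg_right ?_ (Real.exp_pos _).le)
  have hlam1 := (lam_lt_one r).le
  have hMb0 : 0 ≤ Mb := hB0.trans (le_max_left _ _)
  have hsum : (1 - lam r) + lam r = 1 := by ring
  calc B ^ (1 - lam r) * Mb ^ lam r ≤ Mb ^ (1 - lam r) * Mb ^ lam r :=
        mul_le_mul_of_nonneg_right (Real.rpow_le_rpow hB0 (le_max_left _ _) (by linarith)) (Real.rpow_nonneg hMb0 _)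
    _ = Mb := by rw [← Real.rpow_add' hMb0 (by rw [hsum]; exact one_ne_zero), hsum, Real.rpow_one]

/-! ## §4 The three letters of Theorem 3.4 on the complex sup-ball, in one statement -/

/-- ★★ **[B9] THEOREM 3.4 IN KING'S MODEL, MULTI-VARIABLE, WITH LOCALITY.**  For `L ≥ 2`, `a, m² > 0`, `k ≥ 1`, every `0 < r < 1` and all unit sites
`x, y`, on the complex sup-ball `‖w‖_∞ < (r∕(1+r))·min(r_K, potWindow)` of potentials: (a) `w ↦ C^{(k)}_w(x,y)` is ANALYTIC (jointly in all coordinates of `w`),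
(b) `‖C^{(k)}_w(x,y)‖ ≤ 2∕γ₀`, (c) `‖C^{(k)}_w(x,y)‖ ≤ (4∕γ₀)·e^{−(1−λ(r))κ′|x−y|_T}` — «the operators extend to analytic functions … the extended operators
satisfy all the inequalities», here (4.33)–(4.34) of King's model with the two-constants losses.
[cite: Balaban1985BackgroundPropagators, Thm 3.4 p.400, (3.64)–(3.65) p.402, (3.108) p.416 (template); King1986, (4.32)–(4.34) p.674 (A = 0); Ransford1995, Thm. 4.3.7] -/
theorem kingCovCPot_letters (ha : 0 < a) (hm : 0 < m2) (hL : 2 ≤ L) {k : ℕ} (hk : 1 ≤ k) {r : ℝ} (hr0 : 0 < r) (hr1 : r < 1)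
    (x y : Tor (fine L M)) :
    AnalyticOnNhd ℂ (fun w : Tor (fine (L ^ k) (fine L M)) → ℂ => kingCovCPot d a m2 L M k w x y)
        (ball 0 (r / (1 + r) * min (cplxWindow d a m2 L) (potWindow (d + 1) a L))) ∧
      ∀ w : Tor (fine (L ^ k) (fine L M)) → ℂ, ‖w‖ < r / (1 + r) * min (cplxWindow d a m2 L) (potWindow (d + 1) a L) →
        ‖kingCovCPot d a m2 L M k w x y‖ ≤ 2 / gam0L (d + 1) a L ∧
          ‖kingCovCPot d a m2 L M k w x y‖ ≤ 4 / gam0L (d + 1) a L * Real.exp (-((1 - lam r) * kapCT (d + 1) a L * tdistT (fine L M) x y)) := by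
  have hRpos : 0 < min (cplxWindow d a m2 L) (potWindow (d + 1) a L) := (cpotWindow_facts (d := d) (a := a) (m2 := m2) (L := L) ha hm hL).1
  have hrad : r / (1 + r) * min (cplxWindow d a m2 L) (potWindow (d + 1) a L) ≤ min (cplxWindow d a m2 L) (potWindow (d + 1) a L) := by
    have h1 : r / (1 + r) ≤ 1 := (div_le_one (by linarith)).2 (by linarith)
    calc r / (1 + r) * min (cplxWindow d a m2 L) (potWindow (d + 1) a L) ≤ 1 * min (cplxWindow d a m2 L) (potWindow (d + 1) a L) := mul_le_mul_of_nonneg_right h1 hRpos.le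
      _ = _ := one_mul _
  obtain ⟨hA, hBd⟩ := analyticOnNhd_kingCovCPot_apply (d := d) (a := a) (m2 := m2) (M := M) ha hm hL hk x y
  have hsub : ∀ w : Tor (fine (L ^ k) (fine L M)) → ℂ, ‖w‖ < r / (1 + r) * min (cplxWindow d a m2 L) (potWindow (d + 1) a L) → ‖w‖ < cplxWindow d a m2 L := fun w hw =>
    lt_of_lt_of_le hw (hrad.trans (min_le_left _ _))
  refine ⟨fun w hw => hA w (hsub w (mem_ball_zero_iff.1 hw)), fun w hw => ⟨hBd w (hsub w hw), ?_⟩⟩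
  exact kingCovCPot_apply_decay (M := M) ha hm hL hk hr0 hr1 hw x y

end SupBall

end Summit.QuantumFields.YangMills.BalabanUVNodes.N15.KingModel

end
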